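import Summits.Langlands.Langlands.Theorems.PhantomRMYoshidaResiduallyYoshidaLiftingDefs
import Summits.Langlands.Langlands.Theorems.PhantomRMYoshidaResiduallyYoshidaLiftingNumericalCriterionDVR
import HarnessLib

/-!
# Route `PhantomRMYoshida`, crux `ResiduallyYoshidaLifting` (stmt-Langlands-13639), line
# `yoshida-divisor-selmer-count`: the line REDUCED to its two open statements (kernel-checked)

Lead prover's hand-over file for the crux chain (D-0027 §3.2 c "a stub promoted to a crux").
With the two pure-algebra stubs of the line LANDED —
`stub_numericalCriterionDVR` (Wiles–Lenstra / de Smit–Rubin–Schoof Criterion I over a DVR with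
arbitrary residue field, `Theorems/PhantomRMYoshidaResiduallyYoshidaLiftingNumericalCriterionDVR.lean`)
and `stub_stableComponentsModular` (propagation through the component graph,
`Theorems/PhantomRMYoshidaResiduallyYoshidaLiftingDefs.lean`) — everything the line still owes is
number theory, and this file pins down EXACTLY what, over the landed vocabulary
(`DetC Sh Aut IsOrdinaryClassicalLimit IsConnectedInDimTwo`):

* `LocalCriterionDatum`, `YoshidaFamilyDatum` — the line's two `Type`-valued interfaces (verbatim
  from the registered skeleton `Cruxes/ResiduallyYoshidaLifting/Lines/yoshida-divisor-selmer-count.lean`);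
* `YoshidaFamilyExists` — the statement of the open registered stub `stub_yoshidaFamily` (verbatim);
* `EveryShIsLimit` — "on every admissible residual fibre, every irreducible `Sh`-representation is an
  ordinary classical limit" (the standing disprover's formulation, `Disproof.lean` T1');
* `OrdinaryLimitClassicality` — the statement of the open registered stub
  `stub_ordinaryLimitClassicality` (verbatim, lead reshape of 2026-08-16: residual hypotheses
  restored, positional (2,2)-chamber congruence inside `IsOrdinaryClassicalLimit`);

and proves, sorry-free:

* `modular_of_datum`, `isOrdinaryClassicalLimit_of_datum` — inside a Yoshida family datum every
  minimal prime is modular and the point of `ρ` is an ordinary classical limit (the two landed stubs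
  consumed as theorems);
* `yoshidaFamilyExists_iff_everyShIsLimit` — **the registered family stub IS `EveryShIsLimit`**,
  unconditionally (`→` through the two landed stubs; `←` by the junk datum `R = ℚ̄_p`, `I = K = ⊥`
  of the disprover's T1'): the Wiles–Lenstra / propagation architecture constrains the intended
  PROOF of the family stub, not its statement — kernel-checked here, in the tree;
* `residuallyYoshidaLifting_of_everyShIsLimit` — `EveryShIsLimit → OrdinaryLimitClassicality →
  ResiduallyYoshidaLifting` (the crux), and `phantomRMSector_of_everyShIsLimit` — the same two
  statements already give the route TARGET `PhantomRMSector` (the line is absolute: `Aut ρ₀` unused);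
* `ordinaryLimitClassicality_of_phantomRMSector` — conversely the classicality statement is implied
  by the route target (it carries no risk beyond conjunct (B)); so the line's net excess over the
  target is exactly `EveryShIsLimit`.

So a planner promoting the line's open stubs files TWO items — `EveryShIsLimit` (= the route's
foreseen layer L1 "Λ-adic `R^{ord} = T` at the Yoshida `𝔪` in regular weight", in Galois form) and
`OrdinaryLimitClassicality` (= layer L2 "weight-(2,2) specialisation + classicality at an
endoscopic-congruent `𝔪`") — with this file's `residuallyYoshidaLifting_of_everyShIsLimit` as glue.
Both are OPEN IN PRINT (lead census 2026-08-16; nearest: Boxer–Calegari–Gee–Pilloni 2021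
arXiv:1812.09269 Thm 8.4.1 and 2025 arXiv:2502.20645 §4.12, both under residually IRREDUCIBLE
image; Hsieh–Palvannan arXiv:2505.09975 for the Yoshida congruence side).

The registered sub-goal through which this file lands (`--supports stmt-Langlands-13639`) is
`stub_yoshidaFamily_iff_everyShIsLimit : YoshidaFamilyExists ↔ EveryShIsLimit`.
-/

noncomputable section

-- `Summit.Langlands.Langlands.…` (summit = sub-problem name, D-0017 layout) trips `dupNamespace` on every decl.
set_option linter.dupNamespace false
set_option autoImplicit false

open IsDedekindDomain Filter
open Literature.NumberTheory.GaloisRepresentations Literature.NumberTheory.Automorphic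

namespace Summit.Langlands.Langlands.Cruxes.ResiduallyYoshidaLifting.YoshidaDivisorSelmerCount

/-! ## The line's two interfaces (verbatim from the registered skeleton) -/

/-- THE HEIGHT-ONE NUMERICAL-CRITERION DATUM at a prime `P` of `R` (intended: `P ⊇ I` a height-one
prime of the Yoshida divisor `Y = V(I)`, `K = ker(R ↠ T)` the modular ideal).  Wiles–Lenstra data
`A ↠ B → O` over a complete DVR `O` (intended: `O` = completed local ring of the Yoshida branch
`R/I ≅ 𝕀_{F,G}` at `P/I`, whose residue field has characteristic `0` off the `μ`-part; `A = R_P^∧ ⊗ O`,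
`B = T_P^∧ ⊗ O` finite free; `π` = the Yoshida branch as augmentation), TOGETHER WITH the Iwasawa-
theoretic inequality `Φ ≤ Ψ` (`Φ` = `O`-length of the cotangent `𝔭_A/𝔭_A²`, `𝔭_A = ker(π ∘ φ)`;
`Ψ` = `O`-length of `O/η`, `η = π(Ann_B ker π)` the congruence ideal of the Yoshida branch) and the
MEANING of the criterion's conclusion back in `R` (`reflects`: if `φ` is bijective then every minimal
prime of `R` inside `P` is modular).  NO bijectivity is asserted: that is `stub_numericalCriterionDVR`. -/
structure LocalCriterionDatum {R : Type} [CommRing R] (K P : Ideal R) : Type 1 where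
  /-- the base: a complete discrete valuation ring (ANY residue field) -/
  O : Type
  [commRingO : CommRing O]
  [isDomainO : IsDomain O]
  [dvrO : IsDiscreteValuationRing O]
  [completeO : IsAdicComplete (IsLocalRing.maximalIdeal O) O]
  /-- the deformation side: a complete Noetherian local `O`-algebra -/
  A : Type
  [commRingA : CommRing A]
  [localA : IsLocalRing A]
  [noetherianA : IsNoetherianRing A]
  [algebraA : Algebra O A]
  [completeA : IsAdicComplete (IsLocalRing.maximalIdeal A) A]
  /-- the Hecke side: a local `O`-algebra, finite free as an `O`-module -/
  B : Type
  [commRingB : CommRing B]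
  [localB : IsLocalRing B]
  [algebraB : Algebra O B]
  [finiteB : Module.Finite O B]
  [freeB : Module.Free O B]
  /-- `R → T` at `P` -/
  φ : A →ₐ[O] B
  /-- the Yoshida branch as augmentation -/
  π : B →ₐ[O] O
  surjective : Function.Surjective φ
  /-- the congruence ideal `η = π(Ann_B(ker π))` is non-zero -/
  eta_ne_bot : Ideal.map (π : B →+* O) (RingHom.ker (π : B →+* O)).annihilator ≠ ⊥
  /-- `Φ ≤ Ψ`: (Beilinson–Flach upper bound on the transverse cotangent) ≤ (congruence length) -/
  phi_le_psi : Module.length O (RingHom.ker ((π : B →+* O).comp (φ : A →+* B))).Cotangent ≤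
      Module.length O (O ⧸ Ideal.map (π : B →+* O) (RingHom.ker (π : B →+* O)).annihilator)
  /-- meaning: `R_P ≅ T_P` puts every irreducible component of `Spec R` through `P` inside `Spec T` -/
  reflects : Function.Bijective φ → ∀ 𝔮 ∈ minimalPrimes R, 𝔮 ≤ P → K ≤ 𝔮

attribute [instance] LocalCriterionDatum.commRingO LocalCriterionDatum.isDomainO
  LocalCriterionDatum.dvrO LocalCriterionDatum.completeO LocalCriterionDatum.commRingA
  LocalCriterionDatum.localA LocalCriterionDatum.noetherianA LocalCriterionDatum.algebraA
  LocalCriterionDatum.completeA LocalCriterionDatum.commRingB LocalCriterionDatum.localB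
  LocalCriterionDatum.algebraB LocalCriterionDatum.finiteB LocalCriterionDatum.freeB

/-- THE `Λ`-ADIC YOSHIDA FAMILY DATUM of `ρ` — the interface the line is stated over (existence is
STUB 1, never smuggled: every field below is a claim about the intended instance
`R = R^{ps,ord}_{Λ₂,N}(tr σ̄ + tr σ̄')`, `I` = reducibility ideal, `K = ker(R ↠ T^{ord}_{𝔪,N})`).
Only `R` is a ring here; `T` enters through `K` and through the Hecke sides `B` of the local
criterion data; `Λ₂` enters through Krull dimensions only. -/
structure YoshidaFamilyDatum (p : ℕ) [Fact p.Prime] (hcpt : isCompact_glFiniteIntegralLevel 4 ℚ)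
    (ι : PadicAlgCl p ≃+* ℂ) (k : Type) [Field k] [TopologicalSpace k]
    (red : Valued.integer (PadicAlgCl p) →+* k) (σ σ' : FramedGaloisRep ℚ k 2)
    (ρ : FramedGaloisRep ℚ (PadicAlgCl p) 4) : Type 1 where
  /-- the big ordinary pseudodeformation ring `R = R^{ps,ord}_{Λ₂,N}(tr σ̄ + tr σ̄')` -/
  R : Type
  [commRing : CommRing R]
  [isNoetherianRing : IsNoetherianRing R]
  [isLocalRing : IsLocalRing R]
  /-- the reducibility ideal (`V(I) = Y`, the Yoshida divisor) -/
  I : Ideal R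
  /-- the modular ideal `K = ker(R ↠ T^{ord}_𝔪)` -/
  K : Ideal R
  /-- the Yoshida (endoscopic) family is automorphic: `Y ⊆ Spec T` -/
  modular_le_reducible : K ≤ I
  /-- the universal Frobenius polynomials (a.e. `v`) -/
  univPoly : HeightOneSpectrum (NumberField.RingOfIntegers ℚ) → Polynomial R
  /-- the point of `ρ` -/
  x : R →+* PadicAlgCl p
  charpoly_x : ∀ᶠ v : HeightOneSpectrum (NumberField.RingOfIntegers ℚ) in Filter.cofinite,
    ρ.HasFrobCharpolyAt v ((univPoly v).map x)
  /-- the Yoshida divisor is a union of irreducible components of `Spec R` (full `Λ`-dimension) -/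
  yoshida_minimal : ∃ 𝔮 ∈ minimalPrimes R, I ≤ 𝔮
  /-- `Spec R` is connected in dimension `2` -/
  connected₂ : IsConnectedInDimTwo R
  /-- generic propagation between STABLE components meeting in dimension `≥ 2` -/
  generic_propagation : ∀ 𝔮₁ ∈ minimalPrimes R, ∀ 𝔮₂ ∈ minimalPrimes R, ¬ I ≤ 𝔮₁ → ¬ I ≤ 𝔮₂ →
    (2 : WithBot ℕ∞) ≤ ringKrullDim (R ⧸ (𝔮₁ ⊔ 𝔮₂)) → K ≤ 𝔮₁ → K ≤ 𝔮₂
  /-- at every height-one prime of the Yoshida divisor: the numerical-criterion datum with `Φ ≤ Ψ` -/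
  heightOne_criterion : ∀ P : Ideal R, P.IsPrime → I ≤ P → ringKrullDim (R ⧸ P) = 2 →
    Nonempty (LocalCriterionDatum K P)
  /-- Galois points of modular irreducible components are ordinary classical limits -/
  classicalLimit : ∀ (r : FramedGaloisRep ℚ (PadicAlgCl p) 4) (y : R →+* PadicAlgCl p),
    r.toGaloisRep.IsIrreducible → Sh p k red σ σ' r →
      (∀ᶠ v : HeightOneSpectrum (NumberField.RingOfIntegers ℚ) in Filter.cofinite,
        r.HasFrobCharpolyAt v ((univPoly v).map y)) →
      (∃ 𝔮 ∈ minimalPrimes R, 𝔮 ≤ RingHom.ker y ∧ K ≤ 𝔮) → IsOrdinaryClassicalLimit p hcpt ι r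

attribute [instance] YoshidaFamilyDatum.commRing YoshidaFamilyDatum.isNoetherianRing
  YoshidaFamilyDatum.isLocalRing

/-! ## The three open statements -/

/-- Statement of STUB 1 (`stub_yoshidaFamily`): the Λ-adic Yoshida family datum exists. -/
def YoshidaFamilyExists : Prop :=
  ∀ (p : ℕ) [Fact p.Prime], p ≠ 2 → ∀ (k : Type) [Field k] [CharP k p] [IsAlgClosed k]
    [TopologicalSpace k] [DiscreteTopology k] (red : Valued.integer (PadicAlgCl p) →+* k)
    (σ σ' : FramedGaloisRep ℚ k 2) (hcpt : isCompact_glFiniteIntegralLevel 4 ℚ) (ι : PadicAlgCl p ≃+* ℂ)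
    (ρ : FramedGaloisRep ℚ (PadicAlgCl p) 4),
    σ.toGaloisRep.IsIrreducible → σ'.toGaloisRep.IsIrreducible → DetC p k σ σ' →
    (¬ ∃ g : GL (Fin 2) k, ∀ x, g * σ x * g⁻¹ = σ' x) →
    ρ.toGaloisRep.IsIrreducible → Sh p k red σ σ' ρ →
    Nonempty (YoshidaFamilyDatum p hcpt ι k red σ σ' ρ)

/-- `EveryShIsLimit`: on every admissible residual fibre `(p, k, red, σ̄, σ̄', hcpt, ι)` — `σ̄, σ̄'`
irreducible, non-conjugate, `det σ̄ = det σ̄' = ε̄⁻¹` — every IRREDUCIBLE representation `ρ` with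
`Sh ρ` is an ordinary classical limit (`IsOrdinaryClassicalLimit`): pro-automorphy, in regular weight
and in the (2,2)-chamber, of the whole irreducible `Sh`-locus.  Same binders as `YoshidaFamilyExists`,
conclusion replaced (standing disprover's T1').  OPEN IN PRINT. -/
def EveryShIsLimit : Prop :=
  ∀ (p : ℕ) [Fact p.Prime], p ≠ 2 → ∀ (k : Type) [Field k] [CharP k p] [IsAlgClosed k]
    [TopologicalSpace k] [DiscreteTopology k] (red : Valued.integer (PadicAlgCl p) →+* k)
    (σ σ' : FramedGaloisRep ℚ k 2) (hcpt : isCompact_glFiniteIntegralLevel 4 ℚ) (ι : PadicAlgCl p ≃+* ℂ)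
    (ρ : FramedGaloisRep ℚ (PadicAlgCl p) 4),
    σ.toGaloisRep.IsIrreducible → σ'.toGaloisRep.IsIrreducible → DetC p k σ σ' →
    (¬ ∃ g : GL (Fin 2) k, ∀ x, g * σ x * g⁻¹ = σ' x) →
    ρ.toGaloisRep.IsIrreducible → Sh p k red σ σ' ρ → IsOrdinaryClassicalLimit p hcpt ι ρ

/-- Statement of STUB 4 (`stub_ordinaryLimitClassicality`, registered, lead reshape 2026-08-16):
weight-(2,2) classicality of ordinary classical limits at an admissible Yoshida residual type.  OPEN IN
PRINT; implied by the route target (`ordinaryLimitClassicality_of_phantomRMSector`). -/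
def OrdinaryLimitClassicality : Prop :=
  ∀ (p : ℕ) [Fact p.Prime], p ≠ 2 → ∀ (k : Type) [Field k] [CharP k p] [IsAlgClosed k]
    [TopologicalSpace k] [DiscreteTopology k] (red : Valued.integer (PadicAlgCl p) →+* k)
    (σ σ' : FramedGaloisRep ℚ k 2) (hcpt : isCompact_glFiniteIntegralLevel 4 ℚ) (ι : PadicAlgCl p ≃+* ℂ)
    (r : FramedGaloisRep ℚ (PadicAlgCl p) 4),
    σ.toGaloisRep.IsIrreducible → σ'.toGaloisRep.IsIrreducible → DetC p k σ σ' →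
    (¬ ∃ g : GL (Fin 2) k, ∀ x, g * σ x * g⁻¹ = σ' x) →
    r.toGaloisRep.IsIrreducible → Sh p k red σ σ' r → IsOrdinaryClassicalLimit p hcpt ι r →
    Aut p hcpt ι r

/-! ## Inside a datum: every component is modular; the point of `ρ` is a classical limit -/

/-- In a Yoshida family datum EVERY irreducible component of `Spec R` is modular: the height-one
numerical criterion (landed theorem `stub_numericalCriterionDVR`) at each height-one prime of the
Yoshida divisor, read back through `reflects`, feeds the propagation lemma (landed theorem
`stub_stableComponentsModular`). -/
theorem modular_of_datum
    {p : ℕ} [Fact p.Prime] {hcpt : isCompact_glFiniteIntegralLevel 4 ℚ} {ι : PadicAlgCl p ≃+* ℂ}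
    {k : Type} [Field k] [TopologicalSpace k] {red : Valued.integer (PadicAlgCl p) →+* k}
    {σ σ' : FramedGaloisRep ℚ k 2} {ρ : FramedGaloisRep ℚ (PadicAlgCl p) 4}
    (D : YoshidaFamilyDatum p hcpt ι k red σ σ' ρ) :
    ∀ 𝔮 ∈ minimalPrimes D.R, D.K ≤ 𝔮 := by
  refine stub_stableComponentsModular D.R D.I D.K D.modular_le_reducible D.yoshida_minimal
    D.connected₂ D.generic_propagation ?_
  intro P hP hIP hdim 𝔮 h𝔮 hle
  obtain ⟨L⟩ := D.heightOne_criterion P hP hIP hdim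
  exact L.reflects (stub_numericalCriterionDVR L.O L.A L.B L.φ L.π L.surjective L.eta_ne_bot
    L.phi_le_psi) 𝔮 h𝔮 hle

/-- Hence the point `x_ρ` lies on a modular component and `ρ` is an ordinary classical limit. -/
theorem isOrdinaryClassicalLimit_of_datum
    {p : ℕ} [Fact p.Prime] {hcpt : isCompact_glFiniteIntegralLevel 4 ℚ} {ι : PadicAlgCl p ≃+* ℂ}
    {k : Type} [Field k] [TopologicalSpace k] {red : Valued.integer (PadicAlgCl p) →+* k}
    {σ σ' : FramedGaloisRep ℚ k 2} {ρ : FramedGaloisRep ℚ (PadicAlgCl p) 4}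
    (D : YoshidaFamilyDatum p hcpt ι k red σ σ' ρ)
    (hirr : ρ.toGaloisRep.IsIrreducible) (hSh : Sh p k red σ σ' ρ) :
    IsOrdinaryClassicalLimit p hcpt ι ρ := by
  haveI : (RingHom.ker D.x).IsPrime := RingHom.ker_isPrime D.x
  obtain ⟨𝔮, h𝔮, hle⟩ := Ideal.exists_minimalPrimes_le (bot_le : (⊥ : Ideal D.R) ≤ RingHom.ker D.x)
  exact D.classicalLimit ρ D.x hirr hSh D.charpoly_x ⟨𝔮, h𝔮, hle, modular_of_datum D 𝔮 h𝔮⟩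

/-- `YoshidaFamilyExists → EveryShIsLimit` (through the two landed algebra stubs). -/
theorem everyShIsLimit_of_yoshidaFamilyExists (h₁ : YoshidaFamilyExists) : EveryShIsLimit := by
  intro p _ hp k _ _ _ _ _ red σ σ' hcpt ι ρ hσ hσ' hdet hnc hρ hSh
  obtain ⟨D⟩ := h₁ p hp k red σ σ' hcpt ι ρ hσ hσ' hdet hnc hρ hSh
  exact isOrdinaryClassicalLimit_of_datum D hρ hSh

/-! ## The junk datum: `EveryShIsLimit → YoshidaFamilyExists` (disprover's T1', re-checked) -/

/-- The TRIVIAL numerical-criterion datum `O = A = B = ℤ₂`, `φ = π = id` (`η = ⊤ ≠ ⊥`,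
`Φ = ℓ(0) = 0 ≤ Ψ`); `reflects` is the hypothesis `h`. -/
def trivialLocalCriterionDatum {R : Type} [CommRing R] {K P : Ideal R}
    (h : ∀ 𝔮 ∈ minimalPrimes R, 𝔮 ≤ P → K ≤ 𝔮) : LocalCriterionDatum K P where
  O := ℤ_[2]
  A := ℤ_[2]
  B := ℤ_[2]
  φ := AlgHom.id ℤ_[2] ℤ_[2]
  π := AlgHom.id ℤ_[2] ℤ_[2]
  surjective := Function.surjective_id
  eta_ne_bot := by
    have hk : RingHom.ker ((AlgHom.id ℤ_[2] ℤ_[2] : ℤ_[2] →ₐ[ℤ_[2]] ℤ_[2]) : ℤ_[2] →+* ℤ_[2]) = ⊥ := by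
      ext x; simp [RingHom.mem_ker]
    rw [hk, Submodule.annihilator_bot, Ideal.map_top]
    exact top_ne_bot
  phi_le_psi := by
    have hk : RingHom.ker (((AlgHom.id ℤ_[2] ℤ_[2] : ℤ_[2] →ₐ[ℤ_[2]] ℤ_[2]) : ℤ_[2] →+* ℤ_[2]).comp
        ((AlgHom.id ℤ_[2] ℤ_[2] : ℤ_[2] →ₐ[ℤ_[2]] ℤ_[2]) : ℤ_[2] →+* ℤ_[2])) = ⊥ := by
      ext x; simp [RingHom.mem_ker]
    have hsub : Subsingleton (RingHom.ker (((AlgHom.id ℤ_[2] ℤ_[2] : ℤ_[2] →ₐ[ℤ_[2]] ℤ_[2]) :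
        ℤ_[2] →+* ℤ_[2]).comp ((AlgHom.id ℤ_[2] ℤ_[2] : ℤ_[2] →ₐ[ℤ_[2]] ℤ_[2]) :
        ℤ_[2] →+* ℤ_[2]))).Cotangent := by
      rw [Ideal.cotangent_subsingleton_iff, hk]
      simp [IsIdempotentElem]
    rw [Module.length_eq_zero_iff.mpr hsub]
    exact bot_le
  reflects := fun _ => h

open scoped Classical in
/-- A chosen Frobenius polynomial of `ρ` at `v` (junk `0` if none exists). -/
def frobPolyChoice {p : ℕ} [Fact p.Prime] (ρ : FramedGaloisRep ℚ (PadicAlgCl p) 4)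
    (v : HeightOneSpectrum (NumberField.RingOfIntegers ℚ)) : Polynomial (PadicAlgCl p) :=
  if h : ∃ P : Polynomial (PadicAlgCl p), ρ.HasFrobCharpolyAt v P then h.choose else 0

/-- The chosen polynomial is a Frobenius polynomial when one exists. -/
theorem hasFrobCharpolyAt_frobPolyChoice {p : ℕ} [Fact p.Prime]
    {ρ : FramedGaloisRep ℚ (PadicAlgCl p) 4} {v : HeightOneSpectrum (NumberField.RingOfIntegers ℚ)}
    (h : ∃ P : Polynomial (PadicAlgCl p), ρ.HasFrobCharpolyAt v P) :
    ρ.HasFrobCharpolyAt v (frobPolyChoice ρ v) := by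
  classical
  rw [frobPolyChoice, dif_pos h]
  exact h.choose_spec

/-- `Sh ρ` supplies a Frobenius polynomial at almost every place. -/
theorem eventually_exists_hasFrobCharpolyAt_of_sh {p : ℕ} [Fact p.Prime] {k : Type} [Field k]
    [TopologicalSpace k] {red : Valued.integer (PadicAlgCl p) →+* k} {σ σ' : FramedGaloisRep ℚ k 2}
    {ρ : FramedGaloisRep ℚ (PadicAlgCl p) 4} (hSh : Sh p k red σ σ' ρ) :
    ∀ᶠ v : HeightOneSpectrum (NumberField.RingOfIntegers ℚ) in Filter.cofinite,
      ∃ P : Polynomial (PadicAlgCl p), ρ.HasFrobCharpolyAt v P := by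
  filter_upwards [hSh.2.2] with v hv
  obtain ⟨_, _, _, P, _, _, hP, _⟩ := hv
  exact ⟨_, hP⟩

/-- THE JUNK YOSHIDA FAMILY DATUM (`R = ℚ̄_p`, `I = K = ⊥`, `x = id`, `univPoly` = the Frobenius
polynomials of `ρ` itself): all ring-theoretic fields hold trivially and `classicalLimit` is the
GLOBAL limit hypothesis on the fibre — which is why those fields are logically inert. -/
def junkYoshidaFamilyDatum {p : ℕ} [Fact p.Prime] (hcpt : isCompact_glFiniteIntegralLevel 4 ℚ)
    (ι : PadicAlgCl p ≃+* ℂ) {k : Type} [Field k] [TopologicalSpace k]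
    (red : Valued.integer (PadicAlgCl p) →+* k) (σ σ' : FramedGaloisRep ℚ k 2)
    (ρ : FramedGaloisRep ℚ (PadicAlgCl p) 4)
    (hae : ∀ᶠ v : HeightOneSpectrum (NumberField.RingOfIntegers ℚ) in Filter.cofinite,
      ∃ P : Polynomial (PadicAlgCl p), ρ.HasFrobCharpolyAt v P)
    (hlim : ∀ r : FramedGaloisRep ℚ (PadicAlgCl p) 4,
      r.toGaloisRep.IsIrreducible → Sh p k red σ σ' r → IsOrdinaryClassicalLimit p hcpt ι r) :
    YoshidaFamilyDatum p hcpt ι k red σ σ' ρ where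
  R := PadicAlgCl p
  I := ⊥
  K := ⊥
  modular_le_reducible := le_rfl
  univPoly := frobPolyChoice ρ
  x := RingHom.id (PadicAlgCl p)
  charpoly_x := by
    filter_upwards [hae] with v hv
    simpa only [Polynomial.map_id] using hasFrobCharpolyAt_frobPolyChoice hv
  yoshida_minimal := ⟨⊥, by simp [IsDomain.minimalPrimes_eq_singleton_bot], le_rfl⟩
  connected₂ := by
    intro 𝒜 h𝒜 hne hne'
    exfalso
    obtain ⟨q, hq, hq'⟩ := hne'
    obtain ⟨q₀, hq₀⟩ := hne
    have h1 : q = ⊥ := by simpa [IsDomain.minimalPrimes_eq_singleton_bot] using hq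
    have h2 : q₀ = ⊥ := by simpa [IsDomain.minimalPrimes_eq_singleton_bot] using h𝒜 hq₀
    exact hq' (h1 ▸ h2 ▸ hq₀)
  generic_propagation := fun _ _ _ _ _ _ _ _ => bot_le
  heightOne_criterion := fun _ _ _ _ => ⟨trivialLocalCriterionDatum fun _ _ _ => bot_le⟩
  classicalLimit := fun r _ hirr hSh _ _ => hlim r hirr hSh

/-- `EveryShIsLimit → YoshidaFamilyExists` (junk datum; unconditional). -/
theorem yoshidaFamilyExists_of_everyShIsLimit (hL : EveryShIsLimit) : YoshidaFamilyExists := by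
  intro p _ hp k _ _ _ _ _ red σ σ' hcpt ι ρ hσ hσ' hdet hnc hρ hSh
  exact ⟨junkYoshidaFamilyDatum hcpt ι red σ σ' ρ (eventually_exists_hasFrobCharpolyAt_of_sh hSh)
    fun r hr hShr => hL p hp k red σ σ' hcpt ι r hσ hσ' hdet hnc hr hShr⟩

/-- **The registered family stub IS `EveryShIsLimit`** (unconditional now that the two algebra
stubs are theorems).  Registered sub-goal `stub_yoshidaFamily_iff_everyShIsLimit` below. -/
theorem yoshidaFamilyExists_iff_everyShIsLimit : YoshidaFamilyExists ↔ EveryShIsLimit :=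
  ⟨everyShIsLimit_of_yoshidaFamilyExists, yoshidaFamilyExists_of_everyShIsLimit⟩

/-- Registered sub-goal of stmt-Langlands-13639 (name + signature as filed by `stub-add`):
`YoshidaFamilyExists ↔ EveryShIsLimit`. -/
theorem stub_yoshidaFamily_iff_everyShIsLimit : YoshidaFamilyExists ↔ EveryShIsLimit :=
  yoshidaFamilyExists_iff_everyShIsLimit

/-! ## The crux and the route target from the two open statements -/

/-- **Glue for the promoted items.** `EveryShIsLimit → OrdinaryLimitClassicality →
ResiduallyYoshidaLifting`: the crux from the line's two open statements (pure logic; `ρ₀`,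
`Sh ρ₀`, `Aut ρ₀` and both oddness hypotheses are not consumed — the line is absolute). -/
theorem residuallyYoshidaLifting_of_everyShIsLimit (hL : EveryShIsLimit)
    (h₄ : OrdinaryLimitClassicality) :
    Summit.Langlands.Langlands.Theses.PhantomRMYoshida.ResiduallyYoshidaLifting := by
  intro p _ hp k _ _ _ _ _ red σ σ' hcpt ι ρ₀ ρ _εb _Aut _Sh _ _ hσ hσ' hdet hnc _ _ _ hρ hSh
  exact h₄ p hp k red σ σ' hcpt ι ρ hσ hσ' hdet hnc hρ hSh
    (hL p hp k red σ σ' hcpt ι ρ hσ hσ' hdet hnc hρ hSh)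

/-- The same two statements give the route TARGET `PhantomRMSector` (the line is absolute). -/
theorem phantomRMSector_of_everyShIsLimit (hL : EveryShIsLimit) (h₄ : OrdinaryLimitClassicality) :
    Summit.Langlands.Langlands.Theses.PhantomRMYoshida.PhantomRMSector := by
  intro p _ hp k _ _ _ _ _ red σ σ' hcpt ι ρ _εb _ _ hσ hσ' hdet hnc hρ hSh
  exact h₄ p hp k red σ σ' hcpt ι ρ hσ hσ' hdet hnc hρ hSh
    (hL p hp k red σ σ' hcpt ι ρ hσ hσ' hdet hnc hρ hSh)

/-- `ε̄(c) = -1` for every complex conjugation `c ∈ Γ_ℚ` (`εb p` is definitionally Literature's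
`modNCyclotomicCharacter ℚ p`, `εb_eq_modNCyclotomicCharacter`; `conj` inverts roots of unity,
`modNCyclotomicCharacter_of_isComplexConjugation`). -/
theorem εb_of_isComplexConjugation (p : ℕ) [Fact p.Prime] {φ : ℚ →+* ℝ}
    {c : Field.absoluteGaloisGroup ℚ} (hc : IsComplexConjugation φ c) : εb p c = -1 := by
  ext
  rw [εb_eq_modNCyclotomicCharacter, Units.val_neg, Units.val_one]
  exact modNCyclotomicCharacter_of_isComplexConjugation (K := ℚ) (N := p) hc

/-- `det σ̄ = det σ̄' = ε̄⁻¹ ⇒ σ̄, σ̄' odd`: both oddness hypotheses of the crux / target follow from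
the determinant clause `DetC` (disprover's mutation lemma, re-checked in the tree). -/
theorem isOdd_of_detC {p : ℕ} [Fact p.Prime] {k : Type} [Field k] [CharP k p] [TopologicalSpace k]
    [DiscreteTopology k] {σ σ' : FramedGaloisRep ℚ k 2} (hdet : DetC p k σ σ') :
    σ.IsOdd ∧ σ'.IsOdd := by
  have key : ∀ (φ : ℚ →+* ℝ) (c : Field.absoluteGaloisGroup ℚ), IsComplexConjugation φ c →
      FramedRep.det σ c = -1 := by
    intro φ c hc
    rw [(hdet c).1, εb_of_isComplexConjugation p hc]
    ext
    simp
  refine ⟨(FramedGaloisRep.isOdd_iff σ).2 key, (FramedGaloisRep.isOdd_iff σ').2 fun φ c hc => ?_⟩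
  rw [(hdet c).2]
  exact key φ c hc

/-- Conversely the classicality statement is implied by the route target (the limit hypothesis is
simply dropped; oddness comes from `DetC`): it carries no risk beyond conjunct (B).  (Disprover's
T8, re-checked in the tree.) -/
theorem ordinaryLimitClassicality_of_phantomRMSector
    (h : Summit.Langlands.Langlands.Theses.PhantomRMYoshida.PhantomRMSector) :
    OrdinaryLimitClassicality := by
  intro p _ hp k _ _ _ _ _ red σ σ' hcpt ι r hσ hσ' hdet hnc hr hSh _hlim
  exact h p hp k red σ σ' hcpt ι r (isOdd_of_detC hdet).1 (isOdd_of_detC hdet).2 hσ hσ' hdet hnc hr hSh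

end Summit.Langlands.Langlands.Cruxes.ResiduallyYoshidaLifting.YoshidaDivisorSelmerCount

end
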